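import Mathlib
import HarnessLib
import Literature.MathematicalPhysics.QuantumFieldTheory.ConstructiveQFTWave0

/-!
# The 2-torus `(ℤ/L)²`: horizontal / vertical links and rows — product Haar measure as an iterated product

HONEST FRAMING: exact (Metropolis-corrected) sampling algorithms for lattice gauge theory;
figures of merit are autocorrelation/cost numbers at stated couplings and volumes; no
continuum-physics claim.

Venture `LatticeQCDFlow` (cell pub-lqcd), sub-topic `Scoring`; FANOUT row 5 (`s0-sun-a`), GEN-10.
NEW WORK of the cell (placement rule); the combinatorial / measure-theoretic skeleton of step 6b of
row 5's route to the exact SU(2) torus formula (face merging row by row).  For theory-2's lattice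
`Site 2 L = Fin 2 → ZMod L`, `Edge 2 L = Site × Fin 2`, `GaugeConfig 2 L G = Edge 2 L → G`
(`Literature/…/ConstructiveQFTWave0`), any measurable space `G` and any probability measure `μ` on it:

* `integral_gaugeConfig_two_eq` — splitting the links by direction,
  `U ↦ (h, v) = (x ↦ U(x,0), x ↦ U(x,1))`, identifies `μ^{⊗E}` with `μ^{⊗Λ} ⊗ μ^{⊗Λ}`:
  `∫ F dμ^{⊗E} = ∫ F(h ⊔ v) d(μ^{⊗Λ} ⊗ μ^{⊗Λ})`, and (`integral_gaugeConfig_two_eq_integral_integral`)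
  `= ∫ (∫ F(h ⊔ v) dμ^{⊗Λ}(v)) dμ^{⊗Λ}(h)` for integrable `F`;
* `integral_site_two_eq` — currying the sites by ROWS, `v ↦ (j ↦ (i ↦ v(i,j)))`, identifies `μ^{⊗Λ}`
  with `⊗_j μ^{⊗(ℤ/L)}`; hence (`integral_prod_rows`) a product over the rows of functions of the row
  variables integrates to the product of the row integrals;
* `prod_site_two` — `∏_{x ∈ Λ} f x = ∏_j ∏_i f(i,j)`;
* `plaquetteHolonomy_hv` — in these coordinates the plaquette at `(i,j)` is
  `U_{(i,j)} = h(i,j) · v(i+1,j) · h(i,j+1)⁻¹ · v(i,j)⁻¹`: the plaquettes of row `j` involve only the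
  vertical links of row `j` (and horizontal links), which is what makes the row-by-row evaluation of
  the character integrals possible.

Elementary; nothing is cited; no `def` (the maps are written as explicit lambdas,
`fun p e => ![p.1 e.1, p.2 e.1] e.2` and `fun w x => w (x 1) (x 0)`).
-/

noncomputable section

open MeasureTheory Function Set
open Literature.MathematicalPhysics.QuantumFieldTheory

namespace Summit.Ventures.LatticeQCDFlow.Scoring

variable {L : ℕ}

/-! ## §1. Sites of `(ℤ/L)²` as pairs -/

/-- Every site of `(ℤ/L)²` is `![x 0, x 1]`. -/
theorem site_two_eta (x : Site 2 L) : (![x 0, x 1] : Site 2 L) = x := by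
  funext k
  fin_cases k <;> rfl

/-- `∏_{x ∈ Λ} f x = ∏_j ∏_i f(i,j)` on `Λ = (ℤ/L)²`. -/
theorem prod_site_two {M : Type*} [CommMonoid M] [NeZero L] (f : Site 2 L → M) :
    ∏ x : Site 2 L, f x = ∏ j : ZMod L, ∏ i : ZMod L, f ![i, j] := by
  rw [← Fintype.prod_equiv (finTwoArrowEquiv (ZMod L)).symm (fun p : ZMod L × ZMod L => f ![p.1, p.2])
      f (fun p => rfl), Fintype.prod_prod_type_right]

/-- `∀ x ∈ Λ, P x ↔ ∀ i j, P (i,j)`. -/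
theorem forall_site_two {P : Site 2 L → Prop} : (∀ x : Site 2 L, P x) ↔ ∀ i j : ZMod L, P ![i, j] :=
  ⟨fun h i j => h _, fun h x => by rw [← site_two_eta x]; exact h _ _⟩

/-- Shifting `(i,j)` in direction `0` gives `(i+1,j)`. -/
theorem shift_vec2_zero (i j : ZMod L) : Site.shift (![i, j] : Site 2 L) 0 = ![i + 1, j] := by
  funext k
  fin_cases k <;> simp [Site.shift]

/-- Shifting `(i,j)` in direction `1` gives `(i,j+1)`. -/
theorem shift_vec2_one (i j : ZMod L) : Site.shift (![i, j] : Site 2 L) 1 = ![i, j + 1] := by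
  funext k
  fin_cases k <;> simp [Site.shift]

/-! ## §2. Splitting the links by direction: `μ^{⊗E} ≅ μ^{⊗Λ} ⊗ μ^{⊗Λ}` -/

section Split

variable {G : Type*} [MeasurableSpace G] (μ : Measure G) [IsProbabilityMeasure μ]

omit [MeasurableSpace G] in
/-- The preimage of a box of links under `(h, v) ↦ h ⊔ v` is the product of the boxes of horizontal
and of vertical links. -/
theorem hvCombine_preimage_univ_pi (s : Edge 2 L → Set G) :
    (fun (p : (Site 2 L → G) × (Site 2 L → G)) (e : Edge 2 L) => (![p.1 e.1, p.2 e.1] : Fin 2 → G) e.2)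
        ⁻¹' (Set.pi univ s) =
      (Set.pi univ fun x => s (x, 0)) ×ˢ (Set.pi univ fun x => s (x, 1)) := by
  ext ⟨h, v⟩
  simp only [mem_preimage, mem_univ_pi, mem_prod, Prod.forall, Fin.forall_fin_two,
    Matrix.cons_val_zero, Matrix.cons_val_one]
  exact ⟨fun H => ⟨fun x => (H x).1, fun x => (H x).2⟩, fun H x => ⟨H.1 x, H.2 x⟩⟩

omit [IsProbabilityMeasure μ] in
/-- `(h, v) ↦ h ⊔ v` is measurable. -/
theorem measurable_hvCombine :
    Measurable fun (p : (Site 2 L → G) × (Site 2 L → G)) (e : Edge 2 L) =>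
      (![p.1 e.1, p.2 e.1] : Fin 2 → G) e.2 := by
  refine measurable_pi_lambda _ fun e => ?_
  obtain ⟨x, k⟩ := e
  fin_cases k
  · simp only [Fin.zero_eta, Matrix.cons_val_zero]
    exact (measurable_pi_apply x).comp measurable_fst
  · simp only [Fin.mk_one, Matrix.cons_val_one, Matrix.cons_val_zero]
    exact (measurable_pi_apply x).comp measurable_snd

/-- **Splitting the links by direction preserves product measure**: `(h, v) ↦ h ⊔ v` pushes
`μ^{⊗Λ} ⊗ μ^{⊗Λ}` forward to `μ^{⊗E}` (`L ≥ 1`). -/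
theorem measurePreserving_hvCombine [NeZero L] :
    MeasurePreserving (fun (p : (Site 2 L → G) × (Site 2 L → G)) (e : Edge 2 L) =>
        (![p.1 e.1, p.2 e.1] : Fin 2 → G) e.2)
      ((Measure.pi fun _ : Site 2 L => μ).prod (Measure.pi fun _ : Site 2 L => μ))
      (Measure.pi fun _ : Edge 2 L => μ) := by
  refine ⟨measurable_hvCombine, ?_⟩
  symm
  refine Measure.pi_eq fun s hs => ?_
  rw [Measure.map_apply measurable_hvCombine (MeasurableSet.univ_pi hs), hvCombine_preimage_univ_pi,
    Measure.prod_prod, Measure.pi_pi, Measure.pi_pi, Fintype.prod_prod_type, ← Finset.prod_mul_distrib]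
  refine Finset.prod_congr rfl fun x _ => ?_
  rw [Fin.prod_univ_two]

/-- **`∫ F dμ^{⊗E} = ∫ F(h ⊔ v) d(μ^{⊗Λ} ⊗ μ^{⊗Λ})`** for every `F` (no integrability needed: the split
is a measurable equivalence). -/
theorem integral_gaugeConfig_two_eq [NeZero L] {E : Type*} [NormedAddCommGroup E] [NormedSpace ℝ E]
    (F : GaugeConfig 2 L G → E) :
    ∫ U, F U ∂(Measure.pi fun _ : Edge 2 L => μ) =
      ∫ p, F (fun e => (![p.1 e.1, p.2 e.1] : Fin 2 → G) e.2)
        ∂((Measure.pi fun _ : Site 2 L => μ).prod (Measure.pi fun _ : Site 2 L => μ)) := by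
  let Ξ : (Site 2 L → G) × (Site 2 L → G) ≃ᵐ GaugeConfig 2 L G :=
    { toFun := fun p e => (![p.1 e.1, p.2 e.1] : Fin 2 → G) e.2
      invFun := fun U => (fun x => U (x, 0), fun x => U (x, 1))
      left_inv := fun p => by
        obtain ⟨h, v⟩ := p
        simp
      right_inv := fun U => by
        funext e
        obtain ⟨x, k⟩ := e
        fin_cases k <;> simp
      measurable_toFun := measurable_hvCombine
      measurable_invFun := by
        refine Measurable.prodMk ?_ ?_
        · exact measurable_pi_lambda _ fun x => measurable_pi_apply (x, (0 : Fin 2))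
        · exact measurable_pi_lambda _ fun x => measurable_pi_apply (x, (1 : Fin 2)) }
  have hΞ : MeasurePreserving Ξ
      ((Measure.pi fun _ : Site 2 L => μ).prod (Measure.pi fun _ : Site 2 L => μ))
      (Measure.pi fun _ : Edge 2 L => μ) := measurePreserving_hvCombine μ
  exact (hΞ.integral_comp' F).symm

/-- **`∫ F dμ^{⊗E} = ∫ (∫ F(h ⊔ v) dμ^{⊗Λ}(v)) dμ^{⊗Λ}(h)`** for integrable `F` (Fubini after the
split). -/
theorem integral_gaugeConfig_two_eq_integral_integral [NeZero L] {E : Type*} [NormedAddCommGroup E]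
    [NormedSpace ℝ E] (F : GaugeConfig 2 L G → E) (hF : Integrable F (Measure.pi fun _ : Edge 2 L => μ)) :
    ∫ U, F U ∂(Measure.pi fun _ : Edge 2 L => μ) =
      ∫ h, (∫ v, F (fun e => (![h e.1, v e.1] : Fin 2 → G) e.2) ∂(Measure.pi fun _ : Site 2 L => μ))
        ∂(Measure.pi fun _ : Site 2 L => μ) := by
  rw [integral_gaugeConfig_two_eq μ F, integral_prod]
  exact (measurePreserving_hvCombine μ).integrable_comp_of_integrable hF

end Split

/-! ## §3. Currying the sites by rows: `μ^{⊗Λ} ≅ ⊗_j μ^{⊗(ℤ/L)}` -/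

section Rows

variable {X : Type*} [MeasurableSpace X] (μ : Measure X) [SigmaFinite μ]

omit [MeasurableSpace X] in
/-- The preimage of a box of sites under the row currying `w ↦ (x ↦ w (x 1) (x 0))`. -/
theorem rowUncurry_preimage_univ_pi (s : Site 2 L → Set X) :
    (fun (w : ZMod L → ZMod L → X) (x : Site 2 L) => w (x 1) (x 0)) ⁻¹' (Set.pi univ s) =
      Set.pi univ fun j => Set.pi univ fun i => s ![i, j] := by
  ext w
  simp only [mem_preimage, mem_univ_pi, forall_site_two, Matrix.cons_val_zero, Matrix.cons_val_one]
  exact ⟨fun H j i => H i j, fun H i j => H j i⟩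

omit [SigmaFinite μ] in
/-- The row currying is measurable. -/
theorem measurable_rowUncurry :
    Measurable fun (w : ZMod L → ZMod L → X) (x : Site 2 L) => w (x 1) (x 0) :=
  measurable_pi_lambda _ fun x => (measurable_pi_apply (x 0)).comp (measurable_pi_apply (x 1))

/-- **Currying the sites by rows preserves product measure**: `w ↦ (x ↦ w (x 1) (x 0))` pushes
`⊗_j μ^{⊗(ℤ/L)}` forward to `μ^{⊗Λ}` (`L ≥ 1`). -/
theorem measurePreserving_rowUncurry [NeZero L] :
    MeasurePreserving (fun (w : ZMod L → ZMod L → X) (x : Site 2 L) => w (x 1) (x 0))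
      (Measure.pi fun _ : ZMod L => Measure.pi fun _ : ZMod L => μ)
      (Measure.pi fun _ : Site 2 L => μ) := by
  refine ⟨measurable_rowUncurry, ?_⟩
  symm
  refine Measure.pi_eq fun s hs => ?_
  rw [Measure.map_apply measurable_rowUncurry (MeasurableSet.univ_pi hs), rowUncurry_preimage_univ_pi,
    Measure.pi_pi, prod_site_two]
  refine Finset.prod_congr rfl fun j _ => ?_
  rw [Measure.pi_pi]

/-- **`∫ Φ dμ^{⊗Λ} = ∫ Φ(rows ↦ sites) d(⊗_j μ^{⊗(ℤ/L)})`** for every `Φ` (the currying is a measurable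
equivalence). -/
theorem integral_site_two_eq [NeZero L] {E : Type*} [NormedAddCommGroup E] [NormedSpace ℝ E]
    (Φ : (Site 2 L → X) → E) :
    ∫ v, Φ v ∂(Measure.pi fun _ : Site 2 L => μ) =
      ∫ w, Φ (fun x => w (x 1) (x 0)) ∂(Measure.pi fun _ : ZMod L => Measure.pi fun _ : ZMod L => μ) := by
  let Θ : (ZMod L → ZMod L → X) ≃ᵐ (Site 2 L → X) :=
    { toFun := fun w x => w (x 1) (x 0)
      invFun := fun v j i => v ![i, j]
      left_inv := fun w => by
        funext j i
        simp
      right_inv := fun v => by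
        funext x
        simp only
        rw [site_two_eta]
      measurable_toFun := measurable_rowUncurry
      measurable_invFun :=
        measurable_pi_lambda _ fun j => measurable_pi_lambda _ fun i => measurable_pi_apply _ }
  have hΘ : MeasurePreserving Θ (Measure.pi fun _ : ZMod L => Measure.pi fun _ : ZMod L => μ)
      (Measure.pi fun _ : Site 2 L => μ) := measurePreserving_rowUncurry μ
  exact (hΘ.integral_comp' Φ).symm

/-- **Row factorisation**: a product over the rows `j` of functions of the row variables
`(i ↦ v(i,j))` integrates under `μ^{⊗Λ}` to the product of the row integrals under `μ^{⊗(ℤ/L)}`. -/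
theorem integral_prod_rows [NeZero L] (φ : ZMod L → (ZMod L → X) → ℝ) :
    ∫ v, ∏ j, φ j (fun i => v ![i, j]) ∂(Measure.pi fun _ : Site 2 L => μ) =
      ∏ j, ∫ r, φ j r ∂(Measure.pi fun _ : ZMod L => μ) := by
  rw [integral_site_two_eq μ]
  simp only [Matrix.cons_val_zero, Matrix.cons_val_one]
  exact integral_fintype_prod_eq_prod (𝕜 := ℝ) φ

end Rows

/-! ## §4. The plaquette holonomy in horizontal / vertical coordinates -/

/-- **The plaquette at `(i,j)` in `(h, v)` coordinates**: for the configuration `h ⊔ v` built from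
horizontal links `h` and vertical links `v`,
`U_{(i,j)} = h(i,j) · v(i+1,j) · h(i,j+1)⁻¹ · v(i,j)⁻¹`. -/
theorem plaquetteHolonomy_hv {G : Type*} [Group G] (h v : Site 2 L → G) (i j : ZMod L) :
    plaquetteHolonomy (fun e : Edge 2 L => (![h e.1, v e.1] : Fin 2 → G) e.2) ![i, j] 0 1 =
      h ![i, j] * v ![i + 1, j] * (h ![i, j + 1])⁻¹ * (v ![i, j])⁻¹ := by
  simp only [plaquetteHolonomy, shift_vec2_zero, shift_vec2_one, Matrix.cons_val_zero,
    Matrix.cons_val_one]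

/-- The same for a general site `x`: `U_x = h(x) · v(x+e₀) · h(x+e₁)⁻¹ · v(x)⁻¹`. -/
theorem plaquetteHolonomy_hv' {G : Type*} [Group G] (h v : Site 2 L → G) (x : Site 2 L) :
    plaquetteHolonomy (fun e : Edge 2 L => (![h e.1, v e.1] : Fin 2 → G) e.2) x 0 1 =
      h x * v (x.shift 0) * (h (x.shift 1))⁻¹ * (v x)⁻¹ := by
  simp only [plaquetteHolonomy, Matrix.cons_val_zero, Matrix.cons_val_one]

end Summit.Ventures.LatticeQCDFlow.Scoring
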